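import Literature.Analysis.FluidPDE.FiniteFourierModeEulerLoop

/-!
# Kishimoto–Yoneda, §4: transport around a parallelogram of non-interacting modes

Support file for `FiniteFourierModeEuler` (N. Kishimoto, T. Yoneda, J. Math. Fluid Mech. 24
(2022) 74 = arXiv:2110.08039), companion of `FiniteFourierModeEulerLoop`: the mechanism of the
proof of **Proposition 4.7** ("`u_{n₁}` is an eigenvector of the composed rotation `𝓡₁` … hence
`BV⁺` or `BV⁻`") for the closed 4-chains that occur as square faces (the cube, Remark 4.3 (ii):
"SIP is not a transitive relation … four points that form a parallelogram"). All PROVED, with the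
rotation-angle condition made algebraic:

* `loop_algebra₄`: the composed frame matrix of a 4-chain with frame changes
  `[[c_j, τ], [-N_j τ, c_j]]` has off-diagonal entry `T₄ = τ (e₃(c) - ρ τ² e₁(c))` once the four
  squared lengths `N_j` agree (`= ρ`), and an eigenvector `(x, y)` then has `T₄ (ρx² + y²) = 0`;
* `dot_self_eq_zero_of_parallelogram`: for frequencies `n, a, b` and `d = a + b - n` with
  `[n, a, b] ≠ 0`, non-interaction along the four sides `(n,a)`, `(a,d)`, `(d,b)`, `(b,n)` of
  non-zero divergence-free vectors forces `|n| = |a| = |d| = |b|` (the two sides at a vertex of a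
  non-degenerate parallelogram cannot both be in case (ii) of Prop. 2.2, and the mixed assignments
  are contradictory), and then `u_n · u_n = 0` — i.e. `u_n` is `BV^±`
  (`exists_isBV_of_parallelogram`) — provided
  `2|n|²(n·a + n·b) ≠ (|n|² - n·a)(|n|² - n·b)`, which is the condition that the holonomy angle
  `Ω` of the parallelogram (twice that of the triangle `(n, a, b)`) is not a multiple of `π`.

## References

* [KishimotoYoneda2022] N. Kishimoto, T. Yoneda, J. Math. Fluid Mech. 24 (2022) 74 =
  arXiv:2110.08039, §4 Remark 4.3 (ii), Lemma 4.6, Prop. 4.7 (proof).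
-/

noncomputable section

open Matrix

namespace Literature.Analysis.FluidPDE

namespace KY

/-! ### The algebra of a closed 4-chain -/

/-- The composed frame matrix of a 4-chain with equal squared lengths `ρ`: an eigenvector
`(x, y)` satisfies `γ₁γ₂γ₃γ₄ · τ (e₃ - ρτ² e₁) · (ρx² + y²) = 0`, `e₁, e₃` the elementary
symmetric functions of `c₁, …, c₄`. [cite: KishimotoYoneda2022, §4 proof of Prop. 4.7] -/
theorem loop_algebra₄ {x y xa ya x₂ y₂ xd yd x₃ y₃ xb yb x₄ y₄ xn yn γ₁ γ₂ γ₃ γ₄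
    c₁ c₂ c₃ c₄ τ ρ K₁ K₂ K₃ K₄ : ℂ}
    (hK₁ : K₁ ≠ 0) (hK₂ : K₂ ≠ 0) (hK₃ : K₃ ≠ 0) (hK₄ : K₄ ≠ 0)
    (hxa : xa = γ₁ * x) (hya : ya = γ₁ * y)
    (hx₂ : x₂ = (c₁ * xa + τ * ya) / K₂) (hy₂ : y₂ = (-τ * ρ * xa + c₁ * ya) / K₂)
    (hxd : xd = γ₂ * x₂) (hyd : yd = γ₂ * y₂)
    (hx₃ : x₃ = (c₂ * xd + τ * yd) / K₃) (hy₃ : y₃ = (-τ * ρ * xd + c₂ * yd) / K₃)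
    (hxb : xb = γ₃ * x₃) (hyb : yb = γ₃ * y₃)
    (hx₄ : x₄ = (c₃ * xb + τ * yb) / K₄) (hy₄ : y₄ = (-τ * ρ * xb + c₃ * yb) / K₄)
    (hxn : xn = γ₄ * x₄) (hyn : yn = γ₄ * y₄)
    (hx₅ : x = (c₄ * xn + τ * yn) / K₁) (hy₅ : y = (-τ * ρ * xn + c₄ * yn) / K₁) :
    γ₁ * γ₂ * γ₃ * γ₄ *
      (τ * ((c₁ * c₂ * c₃ + c₁ * c₂ * c₄ + c₁ * c₃ * c₄ + c₂ * c₃ * c₄)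
        - ρ * τ ^ 2 * (c₁ + c₂ + c₃ + c₄))) * (ρ * x ^ 2 + y ^ 2) = 0 := by
  have key : x * ((-τ * ρ * xn + c₄ * yn) / K₁) - y * ((c₄ * xn + τ * yn) / K₁) = 0 := by
    rw [← hx₅, ← hy₅]; ring
  subst hxn hyn hx₄ hy₄ hxb hyb hx₃ hy₃ hxd hyd hx₂ hy₂ hxa hya
  field_simp at key
  linear_combination (-1 : ℂ) * key

/-- The local triple products of the parallelogram `n, a, d = a + b - n, b` all equal `[n, a, b]`.
[folklore] -/
theorem parallelogram_triple₁ (n a b : Fin 3 → ℝ) : n ⬝ᵥ (a ⨯₃ (a + b - n)) = n ⬝ᵥ (a ⨯₃ b) := by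
  simp only [real_dot_eq, cross_apply, Pi.add_apply, Pi.sub_apply, Matrix.cons_val_zero,
    Matrix.cons_val_one, Matrix.head_cons, Matrix.cons_val_two, Matrix.tail_cons]
  ring

/-- [folklore] -/
theorem parallelogram_triple₂ (n a b : Fin 3 → ℝ) :
    a ⬝ᵥ ((a + b - n) ⨯₃ b) = n ⬝ᵥ (a ⨯₃ b) := by
  simp only [real_dot_eq, cross_apply, Pi.add_apply, Pi.sub_apply, Matrix.cons_val_zero,
    Matrix.cons_val_one, Matrix.head_cons, Matrix.cons_val_two, Matrix.tail_cons]
  ring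

/-- [folklore] -/
theorem parallelogram_triple₃ (n a b : Fin 3 → ℝ) :
    (a + b - n) ⬝ᵥ (b ⨯₃ n) = n ⬝ᵥ (a ⨯₃ b) := by
  simp only [real_dot_eq, cross_apply, Pi.add_apply, Pi.sub_apply, Matrix.cons_val_zero,
    Matrix.cons_val_one, Matrix.head_cons, Matrix.cons_val_two, Matrix.tail_cons]
  ring

/-- [folklore] -/
theorem parallelogram_triple₄ (n a b : Fin 3 → ℝ) : b ⬝ᵥ (n ⨯₃ a) = n ⬝ᵥ (a ⨯₃ b) := by
  simp only [real_dot_eq, cross_apply, Matrix.cons_val_zero,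
    Matrix.cons_val_one, Matrix.head_cons, Matrix.cons_val_two, Matrix.tail_cons]
  ring


/-! ### Dot products around the parallelogram, in terms of `X = n·a`, `X' = n·b`, `Y = a·b` -/

/-- `c₁ = (n × a)·(a × d)`. [folklore] -/
theorem parallelogram_c₁ (n a b : Fin 3 → ℝ) :
    (n ⨯₃ a) ⬝ᵥ (a ⨯₃ (a + b - n))
      = (n ⬝ᵥ a) * (a ⬝ᵥ a + a ⬝ᵥ b - n ⬝ᵥ a) - (n ⬝ᵥ a + n ⬝ᵥ b - n ⬝ᵥ n) * (a ⬝ᵥ a) := by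
  simp only [real_dot_eq, cross_apply, Pi.add_apply, Pi.sub_apply, Matrix.cons_val_zero,
    Matrix.cons_val_one, Matrix.head_cons, Matrix.cons_val_two, Matrix.tail_cons]
  ring

/-- `c₂ = (a × d)·(d × b)`. [folklore] -/
theorem parallelogram_c₂ (n a b : Fin 3 → ℝ) :
    (a ⨯₃ (a + b - n)) ⬝ᵥ ((a + b - n) ⨯₃ b)
      = (a ⬝ᵥ a + a ⬝ᵥ b - n ⬝ᵥ a) * (a ⬝ᵥ b + b ⬝ᵥ b - n ⬝ᵥ b)
        - (a ⬝ᵥ b) * ((a + b - n) ⬝ᵥ (a + b - n)) := by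
  simp only [real_dot_eq, cross_apply, Pi.add_apply, Pi.sub_apply, Matrix.cons_val_zero,
    Matrix.cons_val_one, Matrix.head_cons, Matrix.cons_val_two, Matrix.tail_cons]
  ring

/-- `c₃ = (d × b)·(b × n)`. [folklore] -/
theorem parallelogram_c₃ (n a b : Fin 3 → ℝ) :
    ((a + b - n) ⨯₃ b) ⬝ᵥ (b ⨯₃ n)
      = (a ⬝ᵥ b + b ⬝ᵥ b - n ⬝ᵥ b) * (n ⬝ᵥ b) - (n ⬝ᵥ a + n ⬝ᵥ b - n ⬝ᵥ n) * (b ⬝ᵥ b) := by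
  simp only [real_dot_eq, cross_apply, Pi.add_apply, Pi.sub_apply, Matrix.cons_val_zero,
    Matrix.cons_val_one, Matrix.head_cons, Matrix.cons_val_two, Matrix.tail_cons]
  ring

/-- `c₄ = (b × n)·(n × a)`. [folklore] -/
theorem parallelogram_c₄ (n a b : Fin 3 → ℝ) :
    (b ⨯₃ n) ⬝ᵥ (n ⨯₃ a) = (n ⬝ᵥ b) * (n ⬝ᵥ a) - (a ⬝ᵥ b) * (n ⬝ᵥ n) := by
  simp only [real_dot_eq, cross_apply, Matrix.cons_val_zero,
    Matrix.cons_val_one, Matrix.head_cons, Matrix.cons_val_two, Matrix.tail_cons]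
  ring

/-- `|d|²`. [folklore] -/
theorem parallelogram_d_sq (n a b : Fin 3 → ℝ) :
    (a + b - n) ⬝ᵥ (a + b - n)
      = a ⬝ᵥ a + b ⬝ᵥ b + n ⬝ᵥ n + 2 * (a ⬝ᵥ b) - 2 * (n ⬝ᵥ a) - 2 * (n ⬝ᵥ b) := by
  simp only [real_dot_eq, Pi.add_apply, Pi.sub_apply]
  ring

/-! ### Around a parallelogram of non-interacting modes -/

section Parallelogram

variable {n a b d : Fin 3 → ℝ} {un ua ud ub : Fin 3 → ℂ}

/-- **Proposition 4.7 for a parallelogram 4-chain.** For `d = a + b - n` with `[n, a, b] ≠ 0`,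
non-interaction along the four sides `(n,a)`, `(a,d)`, `(d,b)`, `(b,n)` of non-zero divergence-free
coefficient vectors, and the angle condition `2|n|²(n·a + n·b) ≠ (|n|² - n·a)(|n|² - n·b)`
(holonomy angle `∉ πℤ`), the vector at `n` is isotropic: `u_n · u_n = 0`.
[cite: KishimotoYoneda2022, §4 Prop. 4.7 (proof) and Remark 4.3 (ii)] -/
theorem dot_self_eq_zero_of_parallelogram (hd : d = a + b - n) (hτ : n ⬝ᵥ (a ⨯₃ b) ≠ 0)
    (hT : 2 * (n ⬝ᵥ n) * (n ⬝ᵥ a + n ⬝ᵥ b) ≠ (n ⬝ᵥ n - n ⬝ᵥ a) * (n ⬝ᵥ n - n ⬝ᵥ b))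
    (hun : un ≠ 0) (hua : ua ≠ 0) (hud : ud ≠ 0) (hub : ub ≠ 0)
    (hdn : dot (cplx n) un = 0) (hda : dot (cplx a) ua = 0) (hdd : dot (cplx d) ud = 0)
    (hdb : dot (cplx b) ub = 0)
    (h₁ : NonInteracting n a un ua) (h₂ : NonInteracting a d ua ud)
    (h₃ : NonInteracting d b ud ub) (h₄ : NonInteracting b n ub un) :
    dot un un = 0 := by
  -- the four local triple products equal `τ`
  have ht₁ : n ⬝ᵥ (a ⨯₃ d) = n ⬝ᵥ (a ⨯₃ b) := by rw [hd, parallelogram_triple₁]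
  have ht₂ : a ⬝ᵥ (d ⨯₃ b) = n ⬝ᵥ (a ⨯₃ b) := by rw [hd, parallelogram_triple₂]
  have ht₃ : d ⬝ᵥ (b ⨯₃ n) = n ⬝ᵥ (a ⨯₃ b) := by rw [hd, parallelogram_triple₃]
  have ht₄ : b ⬝ᵥ (n ⨯₃ a) = n ⬝ᵥ (a ⨯₃ b) := parallelogram_triple₄ n a b
  -- the four normals
  have hk₁ : n ⨯₃ a ≠ 0 := by
    intro h; apply hτ; rw [triple_product_eq_cross_dot, h, zero_dotProduct]
  have hk₂ : a ⨯₃ d ≠ 0 := by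
    intro h; apply hτ; rw [← ht₁, h, dotProduct_zero]
  have hk₃ : d ⨯₃ b ≠ 0 := by
    intro h; apply hτ; rw [← ht₂, h, dotProduct_zero]
  have hk₄ : b ⨯₃ n ≠ 0 := by
    intro h; apply hτ; rw [← ht₃, h, dotProduct_zero]
  have hτ' : ((n ⬝ᵥ (a ⨯₃ b) : ℝ) : ℂ) ≠ 0 := by exact_mod_cast hτ
  have hK₁ : (((n ⨯₃ a) ⬝ᵥ (n ⨯₃ a) : ℝ) : ℂ) ≠ 0 := by exact_mod_cast real_dot_self_ne_zero hk₁
  have hK₂ : (((a ⨯₃ d) ⬝ᵥ (a ⨯₃ d) : ℝ) : ℂ) ≠ 0 := by exact_mod_cast real_dot_self_ne_zero hk₂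
  have hK₃ : (((d ⨯₃ b) ⬝ᵥ (d ⨯₃ b) : ℝ) : ℂ) ≠ 0 := by exact_mod_cast real_dot_self_ne_zero hk₃
  have hK₄ : (((b ⨯₃ n) ⬝ᵥ (b ⨯₃ n) : ℝ) : ℂ) ≠ 0 := by exact_mod_cast real_dot_self_ne_zero hk₄
  -- the chain of frames
  obtain ⟨x, y, hux⟩ := exists_frame₁ hk₁ hdn
  obtain ⟨xa, ya, hua'⟩ := exists_frame₂ hk₁ hda
  obtain ⟨⟨γ₁, hγ₁, hxa, hya⟩, hN₁⟩ := nonInteracting_transport hk₁ hux hua' hun hua h₁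
  have hfa := frame_change n a d xa ya
  rw [← hua', ht₁] at hfa
  have hua2 := eq_div_smul_of_smul_eq hK₂ hfa
  obtain ⟨xd, yd, hud'⟩ := exists_frame₂ hk₂ hdd
  obtain ⟨⟨γ₂, hγ₂, hxd, hyd⟩, hN₂⟩ := nonInteracting_transport hk₂ hua2 hud' hua hud h₂
  have hfd := frame_change a d b xd yd
  rw [← hud', ht₂] at hfd
  have hud2 := eq_div_smul_of_smul_eq hK₃ hfd
  obtain ⟨xb, yb, hub'⟩ := exists_frame₂ hk₃ hdb
  obtain ⟨⟨γ₃, hγ₃, hxb, hyb⟩, hN₃⟩ := nonInteracting_transport hk₃ hud2 hub' hud hub h₃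
  have hfb := frame_change d b n xb yb
  rw [← hub', ht₃] at hfb
  have hub2 := eq_div_smul_of_smul_eq hK₄ hfb
  obtain ⟨xn, yn, hun'⟩ := exists_frame₂ hk₄ hdn
  obtain ⟨⟨γ₄, hγ₄, hxn, hyn⟩, hN₄⟩ := nonInteracting_transport hk₄ hub2 hun' hub hun h₄
  have hfn := frame_change b n a xn yn
  rw [← hun', ht₄] at hfn
  have hun2 := eq_div_smul_of_smul_eq hK₁ hfn
  rw [hux, frame_eq_iff₁ hk₁] at hun2
  obtain ⟨hx₅, hy₅⟩ := hun2
  -- real dot-product bookkeeping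
  have hc₁ := parallelogram_c₁ n a b
  have hc₂ := parallelogram_c₂ n a b
  have hc₃ := parallelogram_c₃ n a b
  have hc₄ := parallelogram_c₄ n a b
  have hdsq := parallelogram_d_sq n a b
  rw [← hd] at hc₁ hc₂ hc₃ hdsq
  -- `a = n`, `b = n` are excluded
  have hXn : ¬ (n ⬝ᵥ a = n ⬝ᵥ n ∧ a ⬝ᵥ a = n ⬝ᵥ n) := by
    rintro ⟨h1, h2⟩
    have : n = a := eq_of_dot_eq_of_norm_eq h2.symm (by rw [h1])
    exact hk₁ (by rw [this, cross_self])
  have hX'n : ¬ (n ⬝ᵥ b = n ⬝ᵥ n ∧ b ⬝ᵥ b = n ⬝ᵥ n) := by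
    rintro ⟨h1, h2⟩
    have : b = n := eq_of_dot_eq_of_norm_eq h2 (by rw [dotProduct_comm, h1, h2])
    exact hk₄ (by rw [this, cross_self])
  -- non-vanishing of the second frame coordinates when the first ones vanish
  have hy0 : x = 0 → y ≠ 0 := by
    rintro rfl rfl; exact hun (by rw [hux]; simp)
  -- STEP 1: all four squared lengths agree
  have hnorm : (a ⬝ᵥ a) = (n ⬝ᵥ n) ∧ (d ⬝ᵥ d) = (n ⬝ᵥ n) ∧ (b ⬝ᵥ b) = (n ⬝ᵥ n) := by
    by_cases hx : x = 0
    · have hy := hy0 hx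
      have hA : ((((n ⨯₃ a) ⬝ᵥ (a ⨯₃ d) : ℝ) : ℂ) * xa + ((n ⬝ᵥ (a ⨯₃ b) : ℝ) : ℂ) * ya) / (((a ⨯₃ d) ⬝ᵥ (a ⨯₃ d) : ℝ) : ℂ) ≠ 0 := by
        rw [hxa, hya, hx]; simp only [mul_zero, zero_add]
        exact div_ne_zero (mul_ne_zero hτ' (mul_ne_zero hγ₁ hy)) hK₂
      have hNad : (a ⬝ᵥ a) = (d ⬝ᵥ d) := hN₂ hA
      by_cases hB : ((((a ⨯₃ d) ⬝ᵥ (d ⨯₃ b) : ℝ) : ℂ) * xd + ((n ⬝ᵥ (a ⨯₃ b) : ℝ) : ℂ) * yd) / (((d ⨯₃ b) ⬝ᵥ (d ⨯₃ b) : ℝ) : ℂ) = 0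
      · exfalso
        -- sides `(n,a)` and `(d,b)` in case (ii)
        have e12 : (((n ⨯₃ a) ⬝ᵥ (a ⨯₃ d) : ℝ) : ℂ) + ((a ⨯₃ d) ⬝ᵥ (d ⨯₃ b)) = 0 := by
          rw [hxd, hyd, hxa, hya, hx] at hB
          field_simp at hB
          have : ((((n ⨯₃ a) ⬝ᵥ (a ⨯₃ d) : ℝ) : ℂ) + ((a ⨯₃ d) ⬝ᵥ (d ⨯₃ b))) * (((n ⬝ᵥ (a ⨯₃ b) : ℝ) : ℂ) * γ₁ * γ₂ * y) = 0 := by linear_combination hB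
          exact (mul_eq_zero.1 this).resolve_right
            (mul_ne_zero (mul_ne_zero (mul_ne_zero hτ' hγ₁) hγ₂) hy)
        have hxb0 : xb = 0 := by rw [hxb, hB, mul_zero]
        have hy₃ : (-((n ⬝ᵥ (a ⨯₃ b) : ℝ) : ℂ) * ((d ⬝ᵥ d : ℝ) : ℂ) * xd + (((a ⨯₃ d) ⬝ᵥ (d ⨯₃ b) : ℝ) : ℂ) * yd) / (((d ⨯₃ b) ⬝ᵥ (d ⨯₃ b) : ℝ) : ℂ) ≠ 0 := by
          intro h0; apply hub; rw [hub', hxb, hyb, hB, h0]; simp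
        have hC : ((((d ⨯₃ b) ⬝ᵥ (b ⨯₃ n) : ℝ) : ℂ) * xb + ((n ⬝ᵥ (a ⨯₃ b) : ℝ) : ℂ) * yb) / (((b ⨯₃ n) ⬝ᵥ (b ⨯₃ n) : ℝ) : ℂ) ≠ 0 := by
          rw [hxb0, hyb]; simp only [mul_zero, zero_add]
          exact div_ne_zero (mul_ne_zero hτ' (mul_ne_zero hγ₃ hy₃)) hK₄
        have hNbn : (b ⬝ᵥ b) = (n ⬝ᵥ n) := hN₄ hC
        have e34 : (((d ⨯₃ b) ⬝ᵥ (b ⨯₃ n) : ℝ) : ℂ) + ((b ⨯₃ n) ⬝ᵥ (n ⨯₃ a)) = 0 := by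
          have h5 := hx₅
          rw [hx, hxn, hyn, hxb0] at h5
          field_simp at h5
          have : ((((d ⨯₃ b) ⬝ᵥ (b ⨯₃ n) : ℝ) : ℂ) + ((b ⨯₃ n) ⬝ᵥ (n ⨯₃ a))) * (((n ⬝ᵥ (a ⨯₃ b) : ℝ) : ℂ) * γ₄ * yb) = 0 := by linear_combination -h5
          have hyb0 : yb ≠ 0 := by rw [hyb]; exact mul_ne_zero hγ₃ hy₃
          exact (mul_eq_zero.1 this).resolve_right (mul_ne_zero (mul_ne_zero hτ' hγ₄) hyb0)
        have e12' : ((n ⨯₃ a) ⬝ᵥ (a ⨯₃ d)) + ((a ⨯₃ d) ⬝ᵥ (d ⨯₃ b)) = 0 := by exact_mod_cast e12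
        have e34' : ((d ⨯₃ b) ⬝ᵥ (b ⨯₃ n)) + ((b ⨯₃ n) ⬝ᵥ (n ⨯₃ a)) = 0 := by exact_mod_cast e34
        have hYv : (a ⬝ᵥ b) = (n ⬝ᵥ a) + (n ⬝ᵥ b) - (n ⬝ᵥ n) := by linarith [hdsq, hNad, hNbn]
        have hc₃' : ((d ⨯₃ b) ⬝ᵥ (b ⨯₃ n)) = ((n ⬝ᵥ n) - (n ⬝ᵥ a)) * ((n ⬝ᵥ n) - (n ⬝ᵥ b)) := by rw [hc₃, hYv, hNbn]; ring
        have hc₄' : ((b ⨯₃ n) ⬝ᵥ (n ⨯₃ a)) = ((n ⬝ᵥ n) - (n ⬝ᵥ a)) * ((n ⬝ᵥ n) - (n ⬝ᵥ b)) := by rw [hc₄, hYv]; ring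
        have hc₁' : ((n ⨯₃ a) ⬝ᵥ (a ⨯₃ d)) = ((n ⬝ᵥ a) - (a ⬝ᵥ a)) * ((n ⬝ᵥ b) - (n ⬝ᵥ n)) := by rw [hc₁, hYv]; ring
        have hc₂' : ((a ⨯₃ d) ⬝ᵥ (d ⨯₃ b)) = ((n ⬝ᵥ a) - (a ⬝ᵥ a)) * ((n ⬝ᵥ b) - (n ⬝ᵥ n)) := by rw [hc₂, hYv, hNbn, ← hNad]; ring
        have p1 : ((n ⬝ᵥ n) - (n ⬝ᵥ a)) * ((n ⬝ᵥ n) - (n ⬝ᵥ b)) = 0 := by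
          linear_combination (1 / 2 : ℝ) * e34' - (1 / 2 : ℝ) * hc₃' - (1 / 2 : ℝ) * hc₄'
        have p2 : ((n ⬝ᵥ a) - (a ⬝ᵥ a)) * ((n ⬝ᵥ b) - (n ⬝ᵥ n)) = 0 := by
          linear_combination (1 / 2 : ℝ) * e12' - (1 / 2 : ℝ) * hc₁' - (1 / 2 : ℝ) * hc₂'
        rcases mul_eq_zero.1 p1 with h | h
        · rcases mul_eq_zero.1 p2 with h' | h'
          · exact hXn ⟨by linarith, by linarith⟩
          · exact hX'n ⟨by linarith, by linarith⟩
        · exact hX'n ⟨by linarith, by linarith⟩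
      · have hNdb : (d ⬝ᵥ d) = (b ⬝ᵥ b) := hN₃ hB
        by_cases hC : ((((d ⨯₃ b) ⬝ᵥ (b ⨯₃ n) : ℝ) : ℂ) * xb + ((n ⬝ᵥ (a ⨯₃ b) : ℝ) : ℂ) * yb) / (((b ⨯₃ n) ⬝ᵥ (b ⨯₃ n) : ℝ) : ℂ) = 0
        · exfalso
          have hxn0 : xn = 0 := by rw [hxn, hC, mul_zero]
          have h5 := hx₅
          rw [hx, hxn0] at h5
          simp only [mul_zero, zero_add] at h5
          have hyn0 : yn = 0 := by
            rcases div_eq_zero_iff.1 h5.symm with h | h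
            · exact (mul_eq_zero.1 h).resolve_left hτ'
            · exact absurd h hK₁
          exact hun (by rw [hun', hxn0, hyn0]; simp)
        · have hNbn : (b ⬝ᵥ b) = (n ⬝ᵥ n) := hN₄ hC
          exact ⟨by rw [hNad, hNdb, hNbn], by rw [hNdb, hNbn], hNbn⟩
    · have hNna : (n ⬝ᵥ n) = (a ⬝ᵥ a) := hN₁ hx
      by_cases hA : ((((n ⨯₃ a) ⬝ᵥ (a ⨯₃ d) : ℝ) : ℂ) * xa + ((n ⬝ᵥ (a ⨯₃ b) : ℝ) : ℂ) * ya) / (((a ⨯₃ d) ⬝ᵥ (a ⨯₃ d) : ℝ) : ℂ) = 0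
      · -- side `(a,d)` in case (ii)
        have hxd0 : xd = 0 := by rw [hxd, hA, mul_zero]
        have hy₂ : (-((n ⬝ᵥ (a ⨯₃ b) : ℝ) : ℂ) * ((a ⬝ᵥ a : ℝ) : ℂ) * xa + (((n ⨯₃ a) ⬝ᵥ (a ⨯₃ d) : ℝ) : ℂ) * ya) / (((a ⨯₃ d) ⬝ᵥ (a ⨯₃ d) : ℝ) : ℂ) ≠ 0 := by
          intro h0; apply hud; rw [hud', hxd, hyd, hA, h0]; simp
        have hB : ((((a ⨯₃ d) ⬝ᵥ (d ⨯₃ b) : ℝ) : ℂ) * xd + ((n ⬝ᵥ (a ⨯₃ b) : ℝ) : ℂ) * yd) / (((d ⨯₃ b) ⬝ᵥ (d ⨯₃ b) : ℝ) : ℂ) ≠ 0 := by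
          rw [hxd0, hyd]; simp only [mul_zero, zero_add]
          exact div_ne_zero (mul_ne_zero hτ' (mul_ne_zero hγ₂ hy₂)) hK₃
        have hNdb : (d ⬝ᵥ d) = (b ⬝ᵥ b) := hN₃ hB
        by_cases hC : ((((d ⨯₃ b) ⬝ᵥ (b ⨯₃ n) : ℝ) : ℂ) * xb + ((n ⬝ᵥ (a ⨯₃ b) : ℝ) : ℂ) * yb) / (((b ⨯₃ n) ⬝ᵥ (b ⨯₃ n) : ℝ) : ℂ) = 0
        · exfalso
          -- sides `(a,d)` and `(b,n)` in case (ii)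
          have e14 : (((n ⨯₃ a) ⬝ᵥ (a ⨯₃ d) : ℝ) : ℂ) + ((b ⨯₃ n) ⬝ᵥ (n ⨯₃ a)) = 0 := by
            have hxn0 : xn = 0 := by rw [hxn, hC, mul_zero]
            have h5 := hx₅
            have h6 := hy₅
            rw [hxn0] at h5 h6
            -- `x = (n ⬝ᵥ (a ⨯₃ b)) yn / ((n ⨯₃ a) ⬝ᵥ (n ⨯₃ a))`, `y = ((b ⨯₃ n) ⬝ᵥ (n ⨯₃ a)) yn / ((n ⨯₃ a) ⬝ᵥ (n ⨯₃ a))`, and `((n ⨯₃ a) ⬝ᵥ (a ⨯₃ d)) x + (n ⬝ᵥ (a ⨯₃ b)) y = 0`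
            have hA' : (((n ⨯₃ a) ⬝ᵥ (a ⨯₃ d) : ℝ) : ℂ) * x + ((n ⬝ᵥ (a ⨯₃ b) : ℝ) : ℂ) * y = 0 := by
              rw [hxa, hya] at hA
              field_simp at hA
              have : ((((n ⨯₃ a) ⬝ᵥ (a ⨯₃ d) : ℝ) : ℂ) * x + ((n ⬝ᵥ (a ⨯₃ b) : ℝ) : ℂ) * y) * γ₁ = 0 := by linear_combination hA
              exact (mul_eq_zero.1 this).resolve_right hγ₁
            rw [h5, h6] at hA'
            field_simp at hA'
            have : ((((n ⨯₃ a) ⬝ᵥ (a ⨯₃ d) : ℝ) : ℂ) + ((b ⨯₃ n) ⬝ᵥ (n ⨯₃ a))) * (((n ⬝ᵥ (a ⨯₃ b) : ℝ) : ℂ) * yn) = 0 := by linear_combination hA'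
            have hyn0 : yn ≠ 0 := by
              intro h0; apply hun; rw [hun', hxn0, h0]; simp
            exact (mul_eq_zero.1 this).resolve_right (mul_ne_zero hτ' hyn0)
          have e23 : (((a ⨯₃ d) ⬝ᵥ (d ⨯₃ b) : ℝ) : ℂ) + ((d ⨯₃ b) ⬝ᵥ (b ⨯₃ n)) = 0 := by
            rw [hxb, hyb, hxd0] at hC
            field_simp at hC
            have hyd0 : yd ≠ 0 := by rw [hyd]; exact mul_ne_zero hγ₂ hy₂
            have : ((((a ⨯₃ d) ⬝ᵥ (d ⨯₃ b) : ℝ) : ℂ) + ((d ⨯₃ b) ⬝ᵥ (b ⨯₃ n))) * (((n ⬝ᵥ (a ⨯₃ b) : ℝ) : ℂ) * γ₃ * yd) = 0 := by linear_combination hC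
            exact (mul_eq_zero.1 this).resolve_right (mul_ne_zero (mul_ne_zero hτ' hγ₃) hyd0)
          have e14' : ((n ⨯₃ a) ⬝ᵥ (a ⨯₃ d)) + ((b ⨯₃ n) ⬝ᵥ (n ⨯₃ a)) = 0 := by exact_mod_cast e14
          have e23' : ((a ⨯₃ d) ⬝ᵥ (d ⨯₃ b)) + ((d ⨯₃ b) ⬝ᵥ (b ⨯₃ n)) = 0 := by exact_mod_cast e23
          have hYv : (a ⬝ᵥ b) = (n ⬝ᵥ a) + (n ⬝ᵥ b) - (n ⬝ᵥ n) := by linarith [hdsq, hNna, hNdb]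
          have hc₁' : ((n ⨯₃ a) ⬝ᵥ (a ⨯₃ d)) = ((n ⬝ᵥ n) - (n ⬝ᵥ a)) * ((n ⬝ᵥ n) - (n ⬝ᵥ b)) := by rw [hc₁, hYv, ← hNna]; ring
          have hc₄' : ((b ⨯₃ n) ⬝ᵥ (n ⨯₃ a)) = ((n ⬝ᵥ n) - (n ⬝ᵥ a)) * ((n ⬝ᵥ n) - (n ⬝ᵥ b)) := by rw [hc₄, hYv]; ring
          have p1 : ((n ⬝ᵥ n) - (n ⬝ᵥ a)) * ((n ⬝ᵥ n) - (n ⬝ᵥ b)) = 0 := by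
            linear_combination (1 / 2 : ℝ) * e14' - (1 / 2 : ℝ) * hc₁' - (1 / 2 : ℝ) * hc₄'
          have p2 : ((n ⬝ᵥ a) - (n ⬝ᵥ n)) * ((n ⬝ᵥ b) - (b ⬝ᵥ b)) = 0 := by
            have : ((a ⨯₃ d) ⬝ᵥ (d ⨯₃ b)) + ((d ⨯₃ b) ⬝ᵥ (b ⨯₃ n)) = 2 * (((n ⬝ᵥ a) - (n ⬝ᵥ n)) * ((n ⬝ᵥ b) - (b ⬝ᵥ b))) := by
              rw [hc₂, hc₃, hYv, ← hNna, hNdb]; ring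
            linear_combination (1 / 2 : ℝ) * e23' - (1 / 2 : ℝ) * this
          rcases mul_eq_zero.1 p1 with h | h
          · exact hXn ⟨by linarith, by linarith⟩
          · rcases mul_eq_zero.1 p2 with h' | h'
            · exact hXn ⟨by linarith, by linarith⟩
            · exact hX'n ⟨by linarith, by linarith⟩
        · have hNbn : (b ⬝ᵥ b) = (n ⬝ᵥ n) := hN₄ hC
          exact ⟨hNna.symm, by rw [hNdb, hNbn], hNbn⟩
      · have hNad : (a ⬝ᵥ a) = (d ⬝ᵥ d) := hN₂ hA
        by_cases hB : ((((a ⨯₃ d) ⬝ᵥ (d ⨯₃ b) : ℝ) : ℂ) * xd + ((n ⬝ᵥ (a ⨯₃ b) : ℝ) : ℂ) * yd) / (((d ⨯₃ b) ⬝ᵥ (d ⨯₃ b) : ℝ) : ℂ) = 0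
        · have hxb0 : xb = 0 := by rw [hxb, hB, mul_zero]
          have hy₃ : (-((n ⬝ᵥ (a ⨯₃ b) : ℝ) : ℂ) * ((d ⬝ᵥ d : ℝ) : ℂ) * xd + (((a ⨯₃ d) ⬝ᵥ (d ⨯₃ b) : ℝ) : ℂ) * yd) / (((d ⨯₃ b) ⬝ᵥ (d ⨯₃ b) : ℝ) : ℂ) ≠ 0 := by
            intro h0; apply hub; rw [hub', hxb, hyb, hB, h0]; simp
          have hC : ((((d ⨯₃ b) ⬝ᵥ (b ⨯₃ n) : ℝ) : ℂ) * xb + ((n ⬝ᵥ (a ⨯₃ b) : ℝ) : ℂ) * yb) / (((b ⨯₃ n) ⬝ᵥ (b ⨯₃ n) : ℝ) : ℂ) ≠ 0 := by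
            rw [hxb0, hyb]; simp only [mul_zero, zero_add]
            exact div_ne_zero (mul_ne_zero hτ' (mul_ne_zero hγ₃ hy₃)) hK₄
          have hNbn : (b ⬝ᵥ b) = (n ⬝ᵥ n) := hN₄ hC
          exact ⟨hNna.symm, by rw [← hNad, ← hNna], hNbn⟩
        · have hNdb : (d ⬝ᵥ d) = (b ⬝ᵥ b) := hN₃ hB
          exact ⟨hNna.symm, by rw [← hNad, ← hNna], by rw [← hNdb, ← hNad, ← hNna]⟩
  obtain ⟨hNa, hNdn, hNb⟩ := hnorm
  -- STEP 2: the loop algebra with equal lengths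
  rw [hNa] at hyd
  rw [hNdn] at hyb
  rw [hNb] at hyn
  have halg := loop_algebra₄ hK₁ hK₂ hK₃ hK₄ hxa hya rfl rfl hxd hyd rfl rfl hxb hyb rfl rfl
    hxn hyn hx₅ hy₅
  -- the four frame angles agree: `c_j = (ρ - (n ⬝ᵥ a))(ρ - (n ⬝ᵥ b))`
  have hYv : (a ⬝ᵥ b) = (n ⬝ᵥ a) + (n ⬝ᵥ b) - (n ⬝ᵥ n) := by linarith [hdsq, hNa, hNdn, hNb]
  have hc₁' : ((n ⨯₃ a) ⬝ᵥ (a ⨯₃ d)) = ((n ⬝ᵥ n) - (n ⬝ᵥ a)) * ((n ⬝ᵥ n) - (n ⬝ᵥ b)) := by rw [hc₁, hYv, hNa]; ring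
  have hc₂' : ((a ⨯₃ d) ⬝ᵥ (d ⨯₃ b)) = ((n ⬝ᵥ n) - (n ⬝ᵥ a)) * ((n ⬝ᵥ n) - (n ⬝ᵥ b)) := by rw [hc₂, hYv, hNa, hNb, hNdn]; ring
  have hc₃' : ((d ⨯₃ b) ⬝ᵥ (b ⨯₃ n)) = ((n ⬝ᵥ n) - (n ⬝ᵥ a)) * ((n ⬝ᵥ n) - (n ⬝ᵥ b)) := by rw [hc₃, hYv, hNb]; ring
  have hc₄' : ((b ⨯₃ n) ⬝ᵥ (n ⨯₃ a)) = ((n ⬝ᵥ n) - (n ⬝ᵥ a)) * ((n ⬝ᵥ n) - (n ⬝ᵥ b)) := by rw [hc₄, hYv]; ring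
  have hτsq : (n ⬝ᵥ (a ⨯₃ b)) ^ 2 = 2 * ((n ⬝ᵥ a) + (n ⬝ᵥ b)) * ((n ⬝ᵥ n) - (n ⬝ᵥ a)) * ((n ⬝ᵥ n) - (n ⬝ᵥ b)) := by
    rw [triple_product_sq, dotProduct_comm b n, hNa, hNb, hYv]; ring
  have hXρ : (n ⬝ᵥ n) - (n ⬝ᵥ a) ≠ 0 := fun h => hXn ⟨by linarith, hNa⟩
  have hX'ρ : (n ⬝ᵥ n) - (n ⬝ᵥ b) ≠ 0 := fun h => hX'n ⟨by linarith, hNb⟩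
  have hT4 : (n ⬝ᵥ (a ⨯₃ b)) * (((n ⨯₃ a) ⬝ᵥ (a ⨯₃ d)) * ((a ⨯₃ d) ⬝ᵥ (d ⨯₃ b)) * ((d ⨯₃ b) ⬝ᵥ (b ⨯₃ n)) + ((n ⨯₃ a) ⬝ᵥ (a ⨯₃ d)) * ((a ⨯₃ d) ⬝ᵥ (d ⨯₃ b)) * ((b ⨯₃ n) ⬝ᵥ (n ⨯₃ a)) + ((n ⨯₃ a) ⬝ᵥ (a ⨯₃ d)) * ((d ⨯₃ b) ⬝ᵥ (b ⨯₃ n)) * ((b ⨯₃ n) ⬝ᵥ (n ⨯₃ a)) + ((a ⨯₃ d) ⬝ᵥ (d ⨯₃ b)) * ((d ⨯₃ b) ⬝ᵥ (b ⨯₃ n)) * ((b ⨯₃ n) ⬝ᵥ (n ⨯₃ a))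
      - (n ⬝ᵥ n) * (n ⬝ᵥ (a ⨯₃ b)) ^ 2 * (((n ⨯₃ a) ⬝ᵥ (a ⨯₃ d)) + ((a ⨯₃ d) ⬝ᵥ (d ⨯₃ b)) + ((d ⨯₃ b) ⬝ᵥ (b ⨯₃ n)) + ((b ⨯₃ n) ⬝ᵥ (n ⨯₃ a)))) ≠ 0 := by
    have : (n ⬝ᵥ (a ⨯₃ b)) * (((n ⨯₃ a) ⬝ᵥ (a ⨯₃ d)) * ((a ⨯₃ d) ⬝ᵥ (d ⨯₃ b)) * ((d ⨯₃ b) ⬝ᵥ (b ⨯₃ n)) + ((n ⨯₃ a) ⬝ᵥ (a ⨯₃ d)) * ((a ⨯₃ d) ⬝ᵥ (d ⨯₃ b)) * ((b ⨯₃ n) ⬝ᵥ (n ⨯₃ a)) + ((n ⨯₃ a) ⬝ᵥ (a ⨯₃ d)) * ((d ⨯₃ b) ⬝ᵥ (b ⨯₃ n)) * ((b ⨯₃ n) ⬝ᵥ (n ⨯₃ a)) + ((a ⨯₃ d) ⬝ᵥ (d ⨯₃ b)) * ((d ⨯₃ b) ⬝ᵥ (b ⨯₃ n)) * ((b ⨯₃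 n) ⬝ᵥ (n ⨯₃ a))
        - (n ⬝ᵥ n) * (n ⬝ᵥ (a ⨯₃ b)) ^ 2 * (((n ⨯₃ a) ⬝ᵥ (a ⨯₃ d)) + ((a ⨯₃ d) ⬝ᵥ (d ⨯₃ b)) + ((d ⨯₃ b) ⬝ᵥ (b ⨯₃ n)) + ((b ⨯₃ n) ⬝ᵥ (n ⨯₃ a))))
        = (n ⬝ᵥ (a ⨯₃ b)) * (4 * (((n ⬝ᵥ n) - (n ⬝ᵥ a)) * ((n ⬝ᵥ n) - (n ⬝ᵥ b))) ^ 2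
          * (((n ⬝ᵥ n) - (n ⬝ᵥ a)) * ((n ⬝ᵥ n) - (n ⬝ᵥ b)) - 2 * (n ⬝ᵥ n) * ((n ⬝ᵥ a) + (n ⬝ᵥ b)))) := by
      rw [hc₁', hc₂', hc₃', hc₄']
      have h2 : (n ⬝ᵥ (a ⨯₃ b)) ^ 2 = 2 * ((n ⬝ᵥ a) + (n ⬝ᵥ b)) * ((n ⬝ᵥ n) - (n ⬝ᵥ a)) * ((n ⬝ᵥ n) - (n ⬝ᵥ b)) := hτsq
      linear_combination (-4 * (n ⬝ᵥ n) * (n ⬝ᵥ (a ⨯₃ b)) * (((n ⬝ᵥ n) - (n ⬝ᵥ a)) * ((n ⬝ᵥ n) - (n ⬝ᵥ b)))) * h2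
    rw [this]
    refine mul_ne_zero hτ (mul_ne_zero (mul_ne_zero four_ne_zero (pow_ne_zero _ (mul_ne_zero hXρ hX'ρ))) ?_)
    intro h; apply hT; linarith
  have hT4' : (((n ⬝ᵥ (a ⨯₃ b)) * (((n ⨯₃ a) ⬝ᵥ (a ⨯₃ d)) * ((a ⨯₃ d) ⬝ᵥ (d ⨯₃ b)) * ((d ⨯₃ b) ⬝ᵥ (b ⨯₃ n)) + ((n ⨯₃ a) ⬝ᵥ (a ⨯₃ d)) * ((a ⨯₃ d) ⬝ᵥ (d ⨯₃ b)) * ((b ⨯₃ n) ⬝ᵥ (n ⨯₃ a)) + ((n ⨯₃ a) ⬝ᵥ (a ⨯₃ d)) * ((d ⨯₃ b) ⬝ᵥ (b ⨯₃ n)) * ((b ⨯₃ n) ⬝ᵥ (n ⨯₃ a)) + ((a ⨯₃ d) ⬝ᵥ (d ⨯₃ b)) * ((d ⨯₃ b) ⬝ᵥ (b ⨯₃ n)) * ((b ⨯₃ n) ⬝ᵥ (n ⨯₃ a))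
      - (n ⬝ᵥ n) * (n ⬝ᵥ (a ⨯₃ b)) ^ 2 * (((n ⨯₃ a) ⬝ᵥ (a ⨯₃ d)) + ((a ⨯₃ d) ⬝ᵥ (d ⨯₃ b)) + ((d ⨯₃ b) ⬝ᵥ (b ⨯₃ n)) + ((b ⨯₃ n) ⬝ᵥ (n ⨯₃ a)))) : ℝ) : ℂ) ≠ 0 := by exact_mod_cast hT4
  push_cast at hT4'
  have hq : ((n ⬝ᵥ n : ℝ) : ℂ) * x ^ 2 + y ^ 2 = 0 :=
    (mul_eq_zero.1 halg).resolve_left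
      (mul_ne_zero (mul_ne_zero (mul_ne_zero (mul_ne_zero hγ₁ hγ₂) hγ₃) hγ₄) hT4')
  rw [hux, dot_self_frame₁, hq, mul_zero]

/-- **Beltrami form**: under the hypotheses of `dot_self_eq_zero_of_parallelogram`, `u_n` is `BV^±`.
[cite: KishimotoYoneda2022, §4 Prop. 4.7] -/
theorem exists_isBV_of_parallelogram (hd : d = a + b - n) (hτ : n ⬝ᵥ (a ⨯₃ b) ≠ 0)
    (hT : 2 * (n ⬝ᵥ n) * (n ⬝ᵥ a + n ⬝ᵥ b) ≠ (n ⬝ᵥ n - n ⬝ᵥ a) * (n ⬝ᵥ n - n ⬝ᵥ b))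
    (hun : un ≠ 0) (hua : ua ≠ 0) (hud : ud ≠ 0) (hub : ub ≠ 0)
    (hdn : dot (cplx n) un = 0) (hda : dot (cplx a) ua = 0) (hdd : dot (cplx d) ud = 0)
    (hdb : dot (cplx b) ub = 0)
    (h₁ : NonInteracting n a un ua) (h₂ : NonInteracting a d ua ud)
    (h₃ : NonInteracting d b ud ub) (h₄ : NonInteracting b n ub un) :
    ∃ μ : ℝ, IsBV μ n un := by
  have hn : n ≠ 0 := by
    rintro rfl; apply hτ; simp
  exact exists_isBV_of_dot_self_eq_zero hn hun hdn
    (dot_self_eq_zero_of_parallelogram hd hτ hT hun hua hud hub hdn hda hdd hdb h₁ h₂ h₃ h₄)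

end Parallelogram

end KY

end Literature.Analysis.FluidPDE
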